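import Summits.QuantumFields.YangMills.Theorems.AlphaInputsT3ACv3StepTrivPinsBlockAvgKnitWindow
import HarnessLib

/-!
# `AlphaInputsT3ACv3StepLowAEPos` — THE `hpos` LETTER OF THE LOWER ROW (R3D-02χ) WEAKENED TO ITS a.e. EDITION (cell `ym3-torus`, ★★OWNER g35's
# (α)-row LOCATE sweep 2026-08-30, row #23 `fibre57LowOn` residue `hpos`; seat `ym3-torus-px20` g13, width copy of p1; `--supports stmt-QuantumFields-19936 --as helper`)

WHAT.  The lower step row `PinnedStep.Fibre57LowOnAC 𝔎 X 𝔖 lo k` ([Balaban1985UV3] (37) p.265 ∕ (47) p.267 ∕ p.272 L32–33, print's χ on the validity family `lo`) is an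
a.e. statement (`≤ᵐ[dV_{k+1}]`).  Its pins road (✓`PinnedStepTrivPins.fibre57LowOnAC_T3_of_le_gamma` ⟸ ✓`…_of_blockAvgChart` ⟸ ✓`…_of_chart`) asks for the POINTWISE
positivity `hpos : ∀ V ∈ lo (k+1), 0 < ∫ U′, 𝟙_T·J·χB(Φ(V,U′))·e^{…} ∂(normalized dU′ (q V))` of the chart fibre integral, used at exactly one point of the proof
(`Real.exp_log`, necessary because `Real.log 0 = 0`) and only at the current `V` inside `filter_upwards`.  Since F2c's chart `(Φ, J, T)` is ∃-packaged
(✓`BlockAvgEMLWeightedFibreChart.exists_weightedFibreChart_global`, `J` an abstract Radon–Nikodym derivative), nothing the tree can say about it gives POINTWISE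
positivity; the a.e. edition is what a chart identity can give.  This file:
* §1 ★ `PinnedStep.fibre57LowOnAC_of_ae_subset_left` — a.e. ANTITONICITY IN THE LEFT FAMILY: if `lo′ k = lo k` and `lo (k+1) ⊆ lo′ (k+1)` `dV_{k+1}`-a.e., then
  `Fibre57LowOnAC lo′ k → Fibre57LowOnAC lo k` (the a.e. sibling of ✓`PinnedStep.fibre57LowOnAC_mono`; `rnTransport_nonneg` off the family);
* §2 ★★ `PinnedStepTrivPins.fibre57LowOnAC_T3_of_le_gamma_of_ae_pos` — ✓`fibre57LowOnAC_T3_of_le_gamma` (:258) VERBATIM with `hpos ↦ hpos_ae : ∀ᵐ V ∂dV_{k+1},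
  V ∈ lo (k+1) → 0 < ∫ …` — proof = the landed theorem applied to `Function.update lo (k+1) (lo (k+1) ∩ {V | 0 < ∫ …})` (whose `hlom`∕`hloinv`∕`hdom` read only
  `lo k`, unchanged) + §1; no proof of p08's lineage is copied.
The honest residue after this file: `hpos_ae` ⟸ `hmap` + `hfib` + Fubini + ONE chart-free letter «the window-restricted one-step push-forward of Haar charges the family»
(`fieldMeasure k ({χB ≠ 0} ∩ avg⁻¹ B) = 0 → fieldMeasure (k+1) B = 0` for `B ⊆ lo (k+1)`), itself the content located in 19936 evidence #57 (print's χ^min point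
`U′ := (blockAvg ℰp)^k Ũ`, the sharp symmetric Prop. 2 ✓`BlockAveragingEMLProp2.plaqSmall_iter_blockAvg_eml`, r1's fibre membership, local submersion of (0.4)) — NOT typed here.

HONEST SCOPE.  [folklore] measure-theoretic bookkeeping; def-free; nothing of [Balaban1985UV3] (37)∕(47)∕(57), of row #23, of the (α) data rows (0∕23), of (O‴χₛ), `HistoryTailL`
(19936), EX, LOWB∘ or `YM3TorusSU2` is proved (rung R3 = SU(2) YM₃ on T³, a RECORD rung: NOT d = 4, NOT infinite volume, NOT a mass gap, NOT Clay; the Yang–Mills mass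
gap is NOT proved).  L-floor: none beyond the family's.
References: T. Bałaban, Commun. Math. Phys. **102** (1985) 255–275 [Balaban1985UV3] ((37) p.265, (47) p.267, (49)–(58) pp.268–270, p.272 L32–33).
-/

set_option autoImplicit false

noncomputable section

/-! ## §1 a.e. antitonicity of the lower row in the left family -/

namespace Summit.QuantumFields.YangMills.Theorems.PinnedStep

open MeasureTheory
open Literature.MathematicalPhysics.QuantumFieldTheory.Balaban1983to89
open Literature.MathematicalPhysics.QuantumFieldTheory.Balaban1983to89.AveragingRT (rnTransport rnTransport_nonneg)
open Literature.MathematicalPhysics.QuantumFieldTheory.Balaban1985CMP102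
open Literature.MathematicalPhysics.QuantumFieldTheory.Balaban1985CMP102.Setting
open Summit.QuantumFields.Balaban3D.Carriers
open Summit.QuantumFields.Balaban3D.Proofs.Inputs (LaneConsts)
open Summit.QuantumFields.Balaban3D.Proofs.TowerAC
open Summit.QuantumFields.Balaban3D.Proofs.StandardAC
open Summit.QuantumFields.Balaban3D.Proofs.InputsAC

variable {L : ℕ} (𝔎 : LaneConsts L) {S : Scales L} {G : Type} [GaugeGroup G] [MeasurableSpace G] [HaarData G]
  {E : Type} [NormedAddCommGroup E] [NormedSpace ℂ E]
  (X : ExternalInputsAC S G) (𝔖 : ∀ k, StepSeries S G E (nblkOf S 𝔎.carrier k) k)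

/-- ★ **a.e. ANTITONICITY OF THE LOWER ROW IN THE LEFT FAMILY**: if two validity families agree INSIDE (`lo′ k = lo k`) and `lo (k+1) ⊆ lo′ (k+1)` holds
`dV_{k+1}`-almost everywhere, then the lower step row on `lo′` implies the one on `lo` — the row's left side carries `𝟙[lo (k+1)] ≤ 𝟙[lo′ (k+1)]` a.e., and
off `lo (k+1)` the right side is a non-negative `rnTransport` (`rnTransport_nonneg`).  The a.e. sibling of ✓`fibre57LowOnAC_mono` (which needs a genuine
inclusion on the left and handles the inside family too). [cite: Balaban1985UV3, (47) p.267 + p.272 L32–33] -/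
theorem fibre57LowOnAC_of_ae_subset_left {lo lo' : (k : ℕ) → Set (GaugeField S.P k G)} (k : ℕ) (hin : lo' k = lo k)
    (hleft : ∀ᵐ V ∂(fieldMeasure S.P (k + 1) G), V ∈ lo (k + 1) → V ∈ lo' (k + 1))
    (h : Fibre57LowOnAC 𝔎 X 𝔖 lo' k) : Fibre57LowOnAC 𝔎 X 𝔖 lo k := by
  unfold Fibre57LowOnAC at h ⊢
  rw [hin] at h
  filter_upwards [h, hleft] with V hV hl
  by_cases hm : V ∈ lo (k + 1)
  · have hm' : V ∈ lo' (k + 1) := hl hm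
    have e : (lo (k + 1)).indicator (fun _ => (1 : ℝ)) V = (lo' (k + 1)).indicator (fun _ => (1 : ℝ)) V := by
      rw [Set.indicator_of_mem hm, Set.indicator_of_mem hm']
    rw [e]
    exact hV
  · rw [Set.indicator_of_notMem hm, zero_mul]
    exact rnTransport_nonneg _ _
      (fun U => mul_nonneg (Set.indicator_nonneg (fun _ _ => zero_le_one) U) (Real.exp_pos _).le) V

end Summit.QuantumFields.YangMills.Theorems.PinnedStep

/-! ## §2 The T³ lower row with the a.e. positivity letter -/

namespace Summit.QuantumFields.YangMills.Theorems.PinnedStepTrivPins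

open MeasureTheory Literature.MathematicalPhysics.QuantumFieldTheory.Balaban1983to89
open Literature.MathematicalPhysics.QuantumFieldTheory.Balaban1983to89.GaugeField (GaugeInvariant gaugeAct)
open Literature.MathematicalPhysics.QuantumFieldTheory.Balaban1983to89.BlockAveraging (avgFun loopHol Idx)
open Literature.MathematicalPhysics.QuantumFieldTheory.Balaban1983to89.ExpMeanLog (expMeanLogSU)
open Literature.MathematicalPhysics.QuantumFieldTheory.Balaban1983to89.T3ContinuumYM3Torus (T3Family)
open Literature.MathematicalPhysics.QuantumFieldTheory.Balaban1983to89.T3UnitScaleTilt (θBal)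
open Literature.MathematicalPhysics.QuantumFieldTheory.Balaban1985CMP102 Literature.MathematicalPhysics.QuantumFieldTheory.Balaban1985CMP102.Setting
open Summit.QuantumFields.Balaban3D.Carriers
open Summit.QuantumFields.Balaban3D.Proofs.Primitives (AlphaConsts)
open Summit.QuantumFields.Balaban3D.Proofs.Thresholds (Q0 Q0_pos)
open Summit.QuantumFields.Balaban3D.Proofs.TowerAC Summit.QuantumFields.Balaban3D.Proofs.StandardAC Summit.QuantumFields.Balaban3D.Proofs.InputsAC
open Summit.QuantumFields.Balaban3D.Proofs.Bound55Masses (chiB)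
open Summit.QuantumFields.Balaban3D.Proofs.GaussianNormalization (partZ normalized)
open Summit.QuantumFields.YangMills.Theorems.PinnedStep (wtP Fibre55WinAC Fibre57LowOnAC)
open scoped NNReal ENNReal

variable {F : T3Family} (𝔠 : AlphaConsts F.L (suGroupModel 2).N) {γ : ℝ} {hγ : 0 < γ} {hγ1' : γ ≤ 1} {K : ℕ}
  {Val : Type} [NormedAddCommGroup Val] [NormedSpace ℂ Val]
  (X : ExternalInputsAC (T3Scales F γ hγ hγ1' K) (Matrix.specialUnitaryGroup (Fin 2) ℂ))
  (𝔖 : ∀ k, StepSeries (T3Scales F γ hγ hγ1' K) (Matrix.specialUnitaryGroup (Fin 2) ℂ) Val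
    (nblkOf (T3Scales F γ hγ hγ1' K) 𝔠.lane.carrier k) k)

/-- ★★ **THE LOWER ROW `Fibre57LowOnAC` AT THE T³ RECORD WITH THE a.e. POSITIVITY LETTER** — ✓`fibre57LowOnAC_T3_of_le_gamma` VERBATIM except that the pointwise
`hpos : ∀ V ∈ lo (k+1), 0 < ∫ …` is replaced by its `dV_{k+1}`-a.e. edition `hpos_ae`.  Proof: the landed theorem applied to the family
`Function.update lo (k+1) (lo (k+1) ∩ {V | 0 < ∫ …})` — its `hlom`∕`hloinv`∕`hdom` read only `lo k` (`Function.update_of_ne`), its pointwise `hpos` holds by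
membership — and §1 transfers the row back to `lo` along the a.e. inclusion.  The letter a chart identity can discharge (module docstring).
[cite: Balaban1985UV3, (37) p.265 + (47) p.267 + (55)–(58) pp.269–270 + p.272 L32–33] -/
theorem fibre57LowOnAC_T3_of_le_gamma_of_ae_pos (hγs : γ ≤ ((((4500 : ℝ) * (F.L : ℝ) ^ 5)⁻¹ / (𝔠.b₀ * Q0 𝔠.p₀)) ^ 2) ^ 2)
    (lo : (k : ℕ) → Set (GaugeField (F.P K) k (Matrix.specialUnitaryGroup (Fin 2) ℂ))) (k : ℕ) (hk : k ≤ K)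
    (hav : (X.av k).avg = avgFun (expMeanLogSU (n := Fin 2)))
    (Φ : GaugeField (F.P K) (k + 1) (Matrix.specialUnitaryGroup (Fin 2) ℂ) × GaugeField (F.P K) k (Matrix.specialUnitaryGroup (Fin 2) ℂ) →
      GaugeField (F.P K) k (Matrix.specialUnitaryGroup (Fin 2) ℂ))
    (J : GaugeField (F.P K) (k + 1) (Matrix.specialUnitaryGroup (Fin 2) ℂ) × GaugeField (F.P K) k (Matrix.specialUnitaryGroup (Fin 2) ℂ) → ℝ≥0)
    (T : Set (GaugeField (F.P K) (k + 1) (Matrix.specialUnitaryGroup (Fin 2) ℂ) × GaugeField (F.P K) k (Matrix.specialUnitaryGroup (Fin 2) ℂ)))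
    (hΦ : Measurable Φ) (hJ : Measurable J) (hT : MeasurableSet T)
    (hmap : ((((fieldMeasure (F.P K) (k + 1) (Matrix.specialUnitaryGroup (Fin 2) ℂ)).prod
        (fieldMeasure (F.P K) k (Matrix.specialUnitaryGroup (Fin 2) ℂ))).restrict T).withDensity (fun z => (J z : ℝ≥0∞))).map Φ =
      (fieldMeasure (F.P K) k (Matrix.specialUnitaryGroup (Fin 2) ℂ)).restrict
        {U : GaugeField (F.P K) k (Matrix.specialUnitaryGroup (Fin 2) ℂ) |
          ∀ c i, dist1 (loopHol U c i) < ((Fintype.card (Idx (F.P K)) : ℝ))⁻¹ / 10})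
    (hfib : ∀ z ∈ T, avgFun (expMeanLogSU (n := Fin 2)) (Φ z) = z.1) (N lσ dg : ℝ)
    (q : GaugeField (F.P K) (k + 1) (Matrix.specialUnitaryGroup (Fin 2) ℂ) → GaugeField (F.P K) k (Matrix.specialUnitaryGroup (Fin 2) ℂ) → ℝ)
    (hqm : ∀ V, Measurable (q V)) (hZ : ∀ V, 0 < partZ (fieldMeasure (F.P K) k (Matrix.specialUnitaryGroup (Fin 2) ℂ)) (q V))
    (hU : Measurable (X.UkH k (Hist.triv (F.P K) k))) (hPm : Measurable ((inputOfAC 𝔠.lane X 𝔖).Pint k (Hist.triv (F.P K) k)))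
    (cP : ℝ) (hPb : ∀ U, (inputOfAC 𝔠.lane X 𝔖).Pint k (Hist.triv (F.P K) k) U ≤ cP)
    (hinv : GaugeInvariant (fun U : GaugeField (F.P K) k (Matrix.specialUnitaryGroup (Fin 2) ℂ) =>
      Real.exp (-((towerOfAC 𝔠.lane X 𝔖).mainT k (Hist.triv (F.P K) k) U) + (towerOfAC 𝔠.lane X 𝔖).Pint k (Hist.triv (F.P K) k) U)))
    (hlom : MeasurableSet (lo k))
    (hloinv : ∀ (u : GaugeTransf (F.P K) k (Matrix.specialUnitaryGroup (Fin 2) ℂ)) (U : GaugeField (F.P K) k (Matrix.specialUnitaryGroup (Fin 2) ℂ)),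
      gaugeAct u U ∈ lo k ↔ U ∈ lo k)
    (hdom : ∀ U : GaugeField (F.P K) k (Matrix.specialUnitaryGroup (Fin 2) ℂ),
      chiB 𝔠.lane.carrier.M₁ (rcolOf (T3Scales F γ hγ hγ1' K) 𝔠.lane.carrier) (eps1Of (T3Scales F γ hγ hγ1' K) 𝔠.lane.carrier) k
        (Hist.triv (F.P K) (k + 1)) U ≠ 0 → U ∈ lo k)
    (hσ : (piecesAC 𝔠.lane X 𝔖 k).logσ₀ = lσ) (hdg : (piecesAC 𝔠.lane X 𝔖 k).dg = dg)
    (hstar : (piecesAC 𝔠.lane X 𝔖 k).starB (Hist.triv (F.P K) (k + 1)) = N)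
    (hZU : ∀ V, (piecesAC 𝔠.lane X 𝔖 k).logZU (Hist.triv (F.P K) (k + 1)) V =
      Real.log (partZ (fieldMeasure (F.P K) k (Matrix.specialUnitaryGroup (Fin 2) ℂ)) (q V)))
    (hFl : ∀ V, (piecesAC 𝔠.lane X 𝔖 k).logFl (Hist.triv (F.P K) (k + 1)) V =
      Real.log (∫ U', (Real.exp (-((lσ + dg * Real.log ((T3Scales F γ hγ hγ1' K).gk k)) * N)) * T.indicator (fun z => (J z : ℝ)) (V, U')) *
              chiB 𝔠.lane.carrier.M₁ (rcolOf (T3Scales F γ hγ hγ1' K) 𝔠.lane.carrier) (eps1Of (T3Scales F γ hγ hγ1' K) 𝔠.lane.carrier) k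
                (Hist.triv (F.P K) (k + 1)) (Φ (V, U')) *
              Real.exp (-((towerOfAC 𝔠.lane X 𝔖).mainT k (Hist.triv (F.P K) k) (Φ (V, U')) -
                    (towerOfAC 𝔠.lane X 𝔖).mainT (k + 1) (Hist.triv (F.P K) (k + 1)) V)
                + ((towerOfAC 𝔠.lane X 𝔖).Pint k (Hist.triv (F.P K) k) (Φ (V, U')) - (piecesAC 𝔠.lane X 𝔖 k).Pold (Hist.triv (F.P K) (k + 1)) V)
                + q V U')
            ∂(normalized (fieldMeasure (F.P K) k (Matrix.specialUnitaryGroup (Fin 2) ℂ)) (q V))))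
    (hpos_ae : ∀ᵐ V ∂(fieldMeasure (F.P K) (k + 1) (Matrix.specialUnitaryGroup (Fin 2) ℂ)), V ∈ lo (k + 1) →
      0 < ∫ U', (Real.exp (-((lσ + dg * Real.log ((T3Scales F γ hγ hγ1' K).gk k)) * N)) * T.indicator (fun z => (J z : ℝ)) (V, U')) *
              chiB 𝔠.lane.carrier.M₁ (rcolOf (T3Scales F γ hγ hγ1' K) 𝔠.lane.carrier) (eps1Of (T3Scales F γ hγ hγ1' K) 𝔠.lane.carrier) k
                (Hist.triv (F.P K) (k + 1)) (Φ (V, U')) *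
              Real.exp (-((towerOfAC 𝔠.lane X 𝔖).mainT k (Hist.triv (F.P K) k) (Φ (V, U')) -
                    (towerOfAC 𝔠.lane X 𝔖).mainT (k + 1) (Hist.triv (F.P K) (k + 1)) V)
                + ((towerOfAC 𝔠.lane X 𝔖).Pint k (Hist.triv (F.P K) k) (Φ (V, U')) - (piecesAC 𝔠.lane X 𝔖 k).Pold (Hist.triv (F.P K) (k + 1)) V)
                + q V U')
            ∂(normalized (fieldMeasure (F.P K) k (Matrix.specialUnitaryGroup (Fin 2) ℂ)) (q V))) :
    Fibre57LowOnAC 𝔠.lane X 𝔖 lo k := by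
  classical
  -- the positivity set of the chart fibre integral at level `k + 1`
  set Pset : Set (GaugeField (F.P K) (k + 1) (Matrix.specialUnitaryGroup (Fin 2) ℂ)) :=
    {V | 0 < ∫ U', (Real.exp (-((lσ + dg * Real.log ((T3Scales F γ hγ hγ1' K).gk k)) * N)) * T.indicator (fun z => (J z : ℝ)) (V, U')) *
                  chiB 𝔠.lane.carrier.M₁ (rcolOf (T3Scales F γ hγ hγ1' K) 𝔠.lane.carrier) (eps1Of (T3Scales F γ hγ hγ1' K) 𝔠.lane.carrier) k
                    (Hist.triv (F.P K) (k + 1)) (Φ (V, U')) *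
                  Real.exp (-((towerOfAC 𝔠.lane X 𝔖).mainT k (Hist.triv (F.P K) k) (Φ (V, U')) -
                        (towerOfAC 𝔠.lane X 𝔖).mainT (k + 1) (Hist.triv (F.P K) (k + 1)) V)
                    + ((towerOfAC 𝔠.lane X 𝔖).Pint k (Hist.triv (F.P K) k) (Φ (V, U')) - (piecesAC 𝔠.lane X 𝔖 k).Pold (Hist.triv (F.P K) (k + 1)) V)
                    + q V U')
                ∂(normalized (fieldMeasure (F.P K) k (Matrix.specialUnitaryGroup (Fin 2) ℂ)) (q V))} with hPset
  have hne : k ≠ k + 1 := by omega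
  have hk' : Function.update lo (k + 1) (lo (k + 1) ∩ Pset) k = lo k := Function.update_of_ne hne _ _
  have h' := fibre57LowOnAC_T3_of_le_gamma 𝔠 X 𝔖 hγs (Function.update lo (k + 1) (lo (k + 1) ∩ Pset)) k hk hav Φ J T hΦ hJ hT hmap
    hfib N lσ dg q hqm hZ hU hPm cP hPb hinv (by rw [hk']; exact hlom) (fun u U => by rw [hk']; exact hloinv u U)
    (fun U hU0 => by rw [hk']; exact hdom U hU0) hσ hdg hstar hZU hFl
    (fun V hV => by rw [Function.update_self] at hV; exact hV.2)
  refine PinnedStep.fibre57LowOnAC_of_ae_subset_left 𝔠.lane X 𝔖 k hk' ?_ h'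
  filter_upwards [hpos_ae] with V hV hm
  rw [Function.update_self]
  exact ⟨hm, hV hm⟩

end Summit.QuantumFields.YangMills.Theorems.PinnedStepTrivPins

end
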